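import Mathlib
import Summits.NavierStokesRegularity.NavierStokesRegularity.Theorems.SubOnsagerCeilingVirtualFloorFaces
import HarnessLib

/-!
# Depth-2 virtual-floor game: face certificates with the damping treated JOINTLY (ratio boxes) + the large-damping regime
(helper file for crux stmt-NavierStokesRegularity-27057 `SubOnsagerCeiling.ForwardTailCeilingKP`, `--supports … --as helper`;
companion of `SubOnsagerCeilingVirtualFloorFaceCert` (`game_of_faceCert`, p672306); LEAD SOC census v10 §H)

`game_of_faceCert` decouples the one scalar damping `d ≥ 0` from the inertial field by a SIGN condition on every active
face (non-decreasing along `(x₀, b2·x₁, b2²·x₂, b2³·x₃)`). For floors `x_{i+1} ≥ h(x_i)` that condition reads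
`x h′(x) ≥ b2·h(x)` — log-slope at least `b² ∈ (2, 4]` — which near `b = 2` forces quartic-type floors far below the
reachable set's quadratic-looking floors and starves the other faces of slack (LEAD g7 numerics at `b ≈ 1.95`). The
alternative is to keep `r = d/Fr` as a PARAMETER: on a box `r ∈ [rlo, rhi]` the face condition is the single affine-in-`r`
inequality `inertial − r·damping < 0` (check the two ends), giving the game statement for plays with `rlo·Fr ≤ d ≤ rhi·Fr`
(`game_of_faceCert_dampingBox`); large ratios need no certificate at all (`game_large_damping`: `d ≥ (7/6)·Fr` keeps every
real shell `≤ 9/10`, using only `L ≤ b2`, `1 ≤ b2`). A finite cover of `[0, 7/6]` by boxes plus the large-damping lemma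
yields the full game hypothesis of `chain_shellBarrier_of_game_geom` at `k₀ = 2`.

HONEST FRAMING: abstract ODE lemmas towards a MODEL-lattice rung (crux `ForwardTailCeilingKP`, route SubOnsagerCeiling,
TL-M2Break); they certify nothing by themselves; nothing here bears on Navier–Stokes regularity; 27057 stays OPEN.
[cite: BarbatoMorandinRomito2011, §2 Lemma 2.1 (invariant-region scheme, viscous terms)] [cite: Hartman2002, Ch. III §4 Cor 4.1]
-/

noncomputable section

-- the sub-problem namespace `NavierStokesRegularity.NavierStokesRegularity` is the tree's layout (D-0017)
set_option linter.dupNamespace false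

namespace Summit.NavierStokesRegularity.NavierStokesRegularity.Theorems.VirtualFloor

open Set Filter Topology

set_option maxHeartbeats 400000 in
/-- **Face certificate with the damping treated JOINTLY on a box of damping ratios `r = d/Fr ∈ [rlo, rhi]`.** When a face
family cannot satisfy the damping SIGN condition of `game_of_faceCert` (near `b = 2` the floors would need log-slope `≥ b²`,
LEAD g7 census v10 §H), one certifies instead, for each box of ratios, the COMBINED inequality
`inertial − r·damping < 0` for all `r ∈ [rlo, rhi]` (affine in `r`: check the two ends); the conclusion is the game
statement for the plays with `rlo·Fr ≤ d ≤ rhi·Fr`. A finite cover of `[0, r*]` by such boxes together with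
`game_large_damping` (`d ≥ r*·Fr`) gives the full game hypothesis.
**The depth-2 game on a damping box from a general face certificate.** Faces `g k : (Fin 4 → ℝ) → ℝ` (`k` in a finite type)
with partial derivatives `dg k i` satisfying the right-sided chain rule `hchain` and continuity `hcont`; region
`Ω = {x : 0 ≤ x i, x 3 ≤ 1, ∀ k, g k x ≤ 0}`. If the datum box `[0,1/10]³ × [0,1]` lies in `Ω` (`hInit`), `Ω ⊂ {x 0, x 1, x 2 < 1}`
(`hSafe`), and every active face satisfies `dg k 3 x ≤ 0`, the strict INERTIAL inequality
`∑ᵢ dg k i x · Φᵢ(V, x) < 0` for all `V ∈ [0,1]` (with `Φ = (V − p x₀x₁, L(x₀² − p x₁x₂), L²(x₁² − p x₂x₃), L³(x₂² − p x₃))`)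
and the DAMPING sign condition `0 ≤ ∑ᵢ dg k i x · b2ⁱ xᵢ` (`hFace`), then every play of the depth-2 rigid-damping virtual-floor
game with constants `(L, p, b2)` and datum `1/10` keeps its real shells `< 1`.
[cite: BarbatoMorandinRomito2011, §2 Lemma 2.1 (first-exit scheme)] -/
theorem game_of_faceCert_dampingBox {ι : Type*} [Finite ι] {L p b2 rlo rhi : ℝ}
    {g : ι → (Fin 4 → ℝ) → ℝ} {dg : ι → Fin 4 → (Fin 4 → ℝ) → ℝ}
    (hcont : ∀ k, Continuous (g k))
    (hchain : ∀ k (X : ℝ → Fin 4 → ℝ) (X' : Fin 4 → ℝ) (t : ℝ),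
      (∀ i, HasDerivWithinAt (fun s => X s i) (X' i) (Ici t) t) →
      HasDerivWithinAt (fun s => g k (X s)) (∑ i, dg k i (X t) * X' i) (Ici t) t)
    (hInit : ∀ x : Fin 4 → ℝ, 0 ≤ x 0 → x 0 ≤ 1 / 10 → 0 ≤ x 1 → x 1 ≤ 1 / 10 → 0 ≤ x 2 → x 2 ≤ 1 / 10 →
      0 ≤ x 3 → x 3 ≤ 1 → ∀ k, g k x ≤ 0)
    (hSafe : ∀ x : Fin 4 → ℝ, (∀ i, 0 ≤ x i) → x 3 ≤ 1 → (∀ k, g k x ≤ 0) → x 0 < 1 ∧ x 1 < 1 ∧ x 2 < 1)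
    (hFace : ∀ k (x : Fin 4 → ℝ), (∀ i, 0 ≤ x i) → x 3 ≤ 1 → (∀ k', g k' x ≤ 0) → g k x = 0 →
      dg k 3 x ≤ 0 ∧
      (∀ r V : ℝ, rlo ≤ r → r ≤ rhi → 0 ≤ V → V ≤ 1 →
        dg k 0 x * (V - p * x 0 * x 1) + dg k 1 x * (L * (x 0 ^ 2 - p * x 1 * x 2)) +
          dg k 2 x * (L ^ 2 * (x 1 ^ 2 - p * x 2 * x 3)) + dg k 3 x * (L ^ 3 * (x 2 ^ 2 - p * x 3)) -
          r * (dg k 0 x * x 0 + dg k 1 x * (b2 * x 1) + dg k 2 x * (b2 ^ 2 * x 2) + dg k 3 x * (b2 ^ 3 * x 3)) < 0)) :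
    ∀ (Fr T : ℝ), 0 < Fr → 0 < T →
      ∀ (S : ℕ → ℝ → ℝ) (d : ℝ) (v y : ℝ → ℝ),
      (∀ i, i ≤ 2 → ContinuousOn (S i) (Icc 0 T)) → ContinuousOn y (Icc 0 T) →
      (∀ i, i ≤ 2 → ∀ t ∈ Ico 0 T, HasDerivWithinAt (S i)
        (-(d * b2 ^ i) * S i t + Fr * L ^ i * ((if i = 0 then v t else S (i - 1) t) ^ 2 -
          p * S i t * (if i = 2 then y t else S (i + 1) t))) (Ici t) t) →
      (∀ t ∈ Ico 0 T, ∃ y' : ℝ, HasDerivWithinAt y y' (Ici t) t ∧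
        -(d * b2 ^ (2 + 1)) * y t + Fr * L ^ (2 + 1) * (S 2 t ^ 2 - p * y t) ≤ y') →
      0 ≤ d →
      (∀ t ∈ Icc 0 T, 0 ≤ v t ∧ v t ≤ 1) → (∀ t ∈ Icc 0 T, 0 ≤ y t ∧ y t ≤ 1) →
      (∀ i, i ≤ 2 → ∀ t ∈ Icc 0 T, 0 ≤ S i t) → (∀ i, i ≤ 2 → S i 0 ≤ 1 / 10) →
      rlo * Fr ≤ d → d ≤ rhi * Fr →
      ∀ i, i ≤ 2 → ∀ t ∈ Icc 0 T, S i t < 1 := by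
  intro Fr T hFr hT S d v y hSc hyc hSd hyd hd hv hy hS0 hSinit hdlo hdhi
  classical
  have hrlo : rlo ≤ d / Fr := by rw [le_div_iff₀ hFr]; exact hdlo
  have hrhi : d / Fr ≤ rhi := by rw [div_le_iff₀ hFr]; exact hdhi
  -- the exact derivatives of the three real shells
  set D0 : ℝ → ℝ := fun t => -(d * b2 ^ 0) * S 0 t + Fr * L ^ 0 * (v t ^ 2 - p * S 0 t * S 1 t) with hD0
  set D1 : ℝ → ℝ := fun t => -(d * b2 ^ 1) * S 1 t + Fr * L ^ 1 * (S 0 t ^ 2 - p * S 1 t * S 2 t) with hD1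
  set D2 : ℝ → ℝ := fun t => -(d * b2 ^ 2) * S 2 t + Fr * L ^ 2 * (S 1 t ^ 2 - p * S 2 t * y t) with hD2
  set Dy : ℝ → ℝ := fun t => -(d * b2 ^ (2 + 1)) * y t + Fr * L ^ (2 + 1) * (S 2 t ^ 2 - p * y t) with hDy
  have hd0 : ∀ t ∈ Ico 0 T, HasDerivWithinAt (S 0) (D0 t) (Ici t) t := by
    intro t ht; simpa [hD0] using hSd 0 (by norm_num) t ht
  have hd1 : ∀ t ∈ Ico 0 T, HasDerivWithinAt (S 1) (D1 t) (Ici t) t := by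
    intro t ht; simpa [hD1] using hSd 1 (by norm_num) t ht
  have hd2 : ∀ t ∈ Ico 0 T, HasDerivWithinAt (S 2) (D2 t) (Ici t) t := by
    intro t ht; simpa [hD2] using hSd 2 (by norm_num) t ht
  -- a chosen right derivative of `y`, bounded below by `Dy`
  have hych : ∀ t, ∃ y' : ℝ, (t ∈ Ico 0 T → HasDerivWithinAt y y' (Ici t) t ∧ Dy t ≤ y') := by
    intro t
    by_cases ht : t ∈ Ico 0 T
    · obtain ⟨y', hy', hlo⟩ := hyd t ht
      exact ⟨y', fun _ => ⟨hy', by simpa [hDy] using hlo⟩⟩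
    · exact ⟨0, fun h => absurd h ht⟩
  choose Y' hY' using hych
  -- the play as a curve in `Fin 4 → ℝ`
  set X : ℝ → Fin 4 → ℝ := fun t => ![S 0 t, S 1 t, S 2 t, y t] with hX
  set X' : ℝ → Fin 4 → ℝ := fun t => ![D0 t, D1 t, D2 t, Y' t] with hX'
  have hX0 : ∀ t, X t 0 = S 0 t := fun t => rfl
  have hX1 : ∀ t, X t 1 = S 1 t := fun t => rfl
  have hX2 : ∀ t, X t 2 = S 2 t := fun t => rfl
  have hX3 : ∀ t, X t 3 = y t := fun t => rfl
  have hXd : ∀ t ∈ Ico 0 T, ∀ i, HasDerivWithinAt (fun s => X s i) (X' t i) (Ici t) t := by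
    intro t ht i
    fin_cases i
    · exact hd0 t ht
    · exact hd1 t ht
    · exact hd2 t ht
    · exact (hY' t ht).1
  -- the faces along the play
  set h : ι → ℝ → ℝ := fun k t => g k (X t) with hh
  set h' : ι → ℝ → ℝ := fun k t => ∑ i, dg k i (X t) * X' t i with hh'
  have hc0 := hSc 0 (by norm_num)
  have hc1 := hSc 1 (by norm_num)
  have hc2 := hSc 2 (by norm_num)
  have hXc : ContinuousOn X (Icc 0 T) := by
    refine continuousOn_pi.2 fun i => ?_
    fin_cases i
    · exact hc0
    · exact hc1
    · exact hc2
    · exact hyc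
  have hhcont : ∀ k, ContinuousOn (h k) (Icc 0 T) := fun k => (hcont k).comp_continuousOn hXc
  have hder : ∀ k, ∀ t ∈ Ico 0 T, HasDerivWithinAt (h k) (h' k t) (Ici t) t :=
    fun k t ht => hchain k X (X' t) t (hXd t ht)
  -- region facts along the play
  have hnn : ∀ t ∈ Icc 0 T, ∀ i, 0 ≤ X t i := by
    intro t ht i
    fin_cases i
    · exact hS0 0 (by norm_num) t ht
    · exact hS0 1 (by norm_num) t ht
    · exact hS0 2 (by norm_num) t ht
    · exact (hy t ht).1
  -- the strict active-face condition
  have hface : ∀ t ∈ Ico 0 T, (∀ j, h j t ≤ 0) → ∀ k, h k t = 0 → h' k t < 0 := by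
    intro t ht hall k hk
    have htI : t ∈ Icc 0 T := Ico_subset_Icc_self ht
    obtain ⟨hy0, hy1⟩ := hy t htI
    obtain ⟨hv0, hv1⟩ := hv t htI
    have hV0 : 0 ≤ v t ^ 2 := sq_nonneg _
    have hV1 : v t ^ 2 ≤ 1 := by nlinarith
    obtain ⟨hm, hQ⟩ := hFace k (X t) (hnn t htI) (by rw [hX3]; exact hy1) hall hk
    have hQV := hQ (d / Fr) (v t ^ 2) hrlo hrhi hV0 hV1
    rw [hX0, hX1, hX2, hX3] at hQV
    change ∑ i, dg k i (X t) * X' t i < 0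
    rw [Fin.sum_univ_four]
    change dg k 0 (X t) * D0 t + dg k 1 (X t) * D1 t + dg k 2 (X t) * D2 t + dg k 3 (X t) * Y' t < 0
    have hylo : Dy t ≤ Y' t := (hY' t ht).2
    have h3 : dg k 3 (X t) * Y' t ≤ dg k 3 (X t) * Dy t := mul_le_mul_of_nonpos_left hylo hm
    have key : dg k 0 (X t) * D0 t + dg k 1 (X t) * D1 t + dg k 2 (X t) * D2 t + dg k 3 (X t) * Dy t =
        Fr * (dg k 0 (X t) * (v t ^ 2 - p * S 0 t * S 1 t) + dg k 1 (X t) * (L * (S 0 t ^ 2 - p * S 1 t * S 2 t)) +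
          dg k 2 (X t) * (L ^ 2 * (S 1 t ^ 2 - p * S 2 t * y t)) + dg k 3 (X t) * (L ^ 3 * (S 2 t ^ 2 - p * y t))) -
        d * (dg k 0 (X t) * S 0 t + dg k 1 (X t) * (b2 * S 1 t) + dg k 2 (X t) * (b2 ^ 2 * S 2 t) +
          dg k 3 (X t) * (b2 ^ 3 * y t)) := by
      simp only [hD0, hD1, hD2, hDy]; ring
    have hneg := mul_neg_of_pos_of_neg hFr hQV
    have hFr0 : Fr ≠ 0 := hFr.ne'
    have hid : Fr * ((dg k 0 (X t) * (v t ^ 2 - p * S 0 t * S 1 t) + dg k 1 (X t) * (L * (S 0 t ^ 2 - p * S 1 t * S 2 t)) +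
          dg k 2 (X t) * (L ^ 2 * (S 1 t ^ 2 - p * S 2 t * y t)) + dg k 3 (X t) * (L ^ 3 * (S 2 t ^ 2 - p * y t))) -
          d / Fr * (dg k 0 (X t) * S 0 t + dg k 1 (X t) * (b2 * S 1 t) + dg k 2 (X t) * (b2 ^ 2 * S 2 t) +
          dg k 3 (X t) * (b2 ^ 3 * y t))) =
        Fr * (dg k 0 (X t) * (v t ^ 2 - p * S 0 t * S 1 t) + dg k 1 (X t) * (L * (S 0 t ^ 2 - p * S 1 t * S 2 t)) +
          dg k 2 (X t) * (L ^ 2 * (S 1 t ^ 2 - p * S 2 t * y t)) + dg k 3 (X t) * (L ^ 3 * (S 2 t ^ 2 - p * y t))) - d * (dg k 0 (X t) * S 0 t + dg k 1 (X t) * (b2 * S 1 t) + dg k 2 (X t) * (b2 ^ 2 * S 2 t) +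
          dg k 3 (X t) * (b2 ^ 3 * y t)) := by
      field_simp
    have h4 : Fr * (dg k 0 (X t) * (v t ^ 2 - p * S 0 t * S 1 t) + dg k 1 (X t) * (L * (S 0 t ^ 2 - p * S 1 t * S 2 t)) +
          dg k 2 (X t) * (L ^ 2 * (S 1 t ^ 2 - p * S 2 t * y t)) + dg k 3 (X t) * (L ^ 3 * (S 2 t ^ 2 - p * y t))) - d * (dg k 0 (X t) * S 0 t + dg k 1 (X t) * (b2 * S 1 t) + dg k 2 (X t) * (b2 ^ 2 * S 2 t) +
          dg k 3 (X t) * (b2 ^ 3 * y t)) < 0 := by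
      rw [← hid]; exact hneg
    linarith
  -- the faces hold initially
  have h0 : ∀ k, h k 0 ≤ 0 := by
    have hT0 : (0 : ℝ) ∈ Icc 0 T := ⟨le_rfl, hT.le⟩
    obtain ⟨hy0, hy1⟩ := hy 0 hT0
    intro k
    exact hInit (X 0) (hS0 0 (by norm_num) 0 hT0) (hSinit 0 (by norm_num)) (hS0 1 (by norm_num) 0 hT0)
      (hSinit 1 (by norm_num)) (hS0 2 (by norm_num) 0 hT0) (hSinit 2 (by norm_num)) hy0 hy1 k
  -- first exit
  have hall := forall_le_of_hasDerivWithinAt_Ici_of_active_lt (c := fun _ => (0 : ℝ)) hhcont hder hface h0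
  intro i hi t ht
  obtain ⟨h0lt, h1lt, h2lt⟩ := hSafe (X t) (hnn t ht) (by rw [hX3]; exact (hy t ht).2) (hall t ht)
  interval_cases i
  · exact h0lt
  · exact h1lt
  · exact h2lt


/-- **Large damping.** If the damping ratio is at least `7/6` (`(7/6)·Fr ≤ d`), every play of the depth-2 game keeps its
real shells `≤ 9/10 < 1`, whatever the faces: each shell obeys `Ṡᵢ ≤ −d·b2ⁱ·Sᵢ + Fr·Lⁱ·feedᵢ²` and the feeds are bounded
in turn (`v ≤ 1`, then `S₀ ≤ 9/10`, then `S₁ ≤ 9/10` using `L ≤ b2`), so the scalar barrier `Sᵢ ≤ 9/10` is strictly inward.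
Requires `L ≤ b2` (for the lattice `L = b^{399/200} ≤ b² = b2` when `b ≥ 1`) and `1 ≤ b2`. -/
theorem game_large_damping {L p b2 : ℝ} (hL : 0 ≤ L) (hLb : L ≤ b2) (hb2 : 1 ≤ b2) (hp : 0 ≤ p) :
    ∀ (Fr T : ℝ), 0 < Fr → 0 < T →
      ∀ (S : ℕ → ℝ → ℝ) (d : ℝ) (v y : ℝ → ℝ),
      (∀ i, i ≤ 2 → ContinuousOn (S i) (Icc 0 T)) → ContinuousOn y (Icc 0 T) →
      (∀ i, i ≤ 2 → ∀ t ∈ Ico 0 T, HasDerivWithinAt (S i)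
        (-(d * b2 ^ i) * S i t + Fr * L ^ i * ((if i = 0 then v t else S (i - 1) t) ^ 2 -
          p * S i t * (if i = 2 then y t else S (i + 1) t))) (Ici t) t) →
      (∀ t ∈ Ico 0 T, ∃ y' : ℝ, HasDerivWithinAt y y' (Ici t) t ∧
        -(d * b2 ^ (2 + 1)) * y t + Fr * L ^ (2 + 1) * (S 2 t ^ 2 - p * y t) ≤ y') →
      0 ≤ d →
      (∀ t ∈ Icc 0 T, 0 ≤ v t ∧ v t ≤ 1) → (∀ t ∈ Icc 0 T, 0 ≤ y t ∧ y t ≤ 1) →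
      (∀ i, i ≤ 2 → ∀ t ∈ Icc 0 T, 0 ≤ S i t) → (∀ i, i ≤ 2 → S i 0 ≤ 1 / 10) →
      7 / 6 * Fr ≤ d →
      ∀ i, i ≤ 2 → ∀ t ∈ Icc 0 T, S i t < 1 := by
  intro Fr T hFr hT S d v y hSc hyc hSd hyd hd hv hy hS0 hSinit hdlo
  -- the three scalar barriers `S i ≤ 9/10`, proved jointly by the first-exit lemma
  set h : Fin 3 → ℝ → ℝ := fun k t => S k t with hh
  set D : Fin 3 → ℝ → ℝ := fun k t =>
    -(d * b2 ^ (k : ℕ)) * S k t + Fr * L ^ (k : ℕ) * ((if (k : ℕ) = 0 then v t else S (k - 1) t) ^ 2 -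
      p * S k t * (if (k : ℕ) = 2 then y t else S (k + 1) t)) with hD
  have hder : ∀ k : Fin 3, ∀ t ∈ Ico 0 T, HasDerivWithinAt (h k) (D k t) (Ici t) t := by
    intro k t ht
    have := hSd k (by have := k.is_lt; omega) t ht
    simpa [hh, hD] using this
  have hcont' : ∀ k : Fin 3, ContinuousOn (h k) (Icc 0 T) := fun k => hSc k (by have := k.is_lt; omega)
  have hdpos : 0 < d := lt_of_lt_of_le (by positivity) hdlo
  have hface : ∀ t ∈ Ico 0 T, (∀ j : Fin 3, h j t ≤ 9 / 10) → ∀ k : Fin 3, h k t = 9 / 10 → D k t < 0 := by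
    intro t ht hall k hk
    have htI : t ∈ Icc 0 T := Ico_subset_Icc_self ht
    obtain ⟨hv0, hv1⟩ := hv t htI
    obtain ⟨hy0, hy1⟩ := hy t htI
    have hS0' := hS0 0 (by norm_num) t htI
    have hS1' := hS0 1 (by norm_num) t htI
    have hS2' := hS0 2 (by norm_num) t htI
    have h0le : S 0 t ≤ 9 / 10 := hall 0
    have h1le : S 1 t ≤ 9 / 10 := hall 1
    have hb2pos : 0 < b2 := by linarith
    fin_cases k
    · -- shell 0: `Ṡ₀ ≤ -d S₀ + Fr ≤ -(7/6) Fr (9/10) + Fr < 0`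
      have hk0 : S 0 t = 9 / 10 := hk
      change -(d * b2 ^ ((0 : Fin 3) : ℕ)) * S 0 t + Fr * L ^ ((0 : Fin 3) : ℕ) *
        ((if ((0 : Fin 3) : ℕ) = 0 then v t else S (0 - 1) t) ^ 2 - p * S 0 t * (if ((0 : Fin 3) : ℕ) = 2 then y t else S (0 + 1) t)) < 0
      simp only [Fin.val_zero, pow_zero, if_true, show ((0 : ℕ) = 2) = False by decide, if_false]
      have hv2 : v t ^ 2 ≤ 1 := by nlinarith
      have hdr : 0 ≤ p * S 0 t * S (0 + 1) t := by
        have := hS0 1 (by norm_num) t htI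
        positivity
      nlinarith
    · -- shell 1: `Ṡ₁ ≤ -d b2 S₁ + Fr L S₀² ≤ -(7/6) Fr b2 (9/10) + Fr L (81/100) < 0` using `L ≤ b2`
      have hk1 : S 1 t = 9 / 10 := hk
      change -(d * b2 ^ ((1 : Fin 3) : ℕ)) * S 1 t + Fr * L ^ ((1 : Fin 3) : ℕ) *
        ((if ((1 : Fin 3) : ℕ) = 0 then v t else S (1 - 1) t) ^ 2 - p * S 1 t * (if ((1 : Fin 3) : ℕ) = 2 then y t else S (1 + 1) t)) < 0
      simp only [Fin.val_one, pow_one, show ((1 : ℕ) = 0) = False by decide, show ((1 : ℕ) = 2) = False by decide,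
        if_false, Nat.sub_self]
      have hsq : S 0 t ^ 2 ≤ 81 / 100 := by nlinarith
      have hS2'' : 0 ≤ S (1 + 1) t := hS0 2 (by norm_num) t htI
      have hdr : 0 ≤ p * S 1 t * S (1 + 1) t := by positivity
      have hFL : 0 ≤ Fr * L := mul_nonneg hFr.le hL
      have a1 : Fr * L * (S 0 t ^ 2 - p * S 1 t * S (1 + 1) t) ≤ Fr * L * (81 / 100) :=
        mul_le_mul_of_nonneg_left (by linarith) hFL
      have a2 : Fr * L * (81 / 100 : ℝ) ≤ Fr * b2 * (81 / 100) := by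
        have := mul_le_mul_of_nonneg_left hLb hFr.le
        nlinarith
      have a3 : 7 / 6 * Fr * b2 ≤ d * b2 := mul_le_mul_of_nonneg_right hdlo hb2pos.le
      have hFb : 0 < Fr * b2 := mul_pos hFr hb2pos
      have e : -(d * b2) * S 1 t = -(9 / 10) * (d * b2) := by rw [hk1]; ring
      nlinarith
    · -- shell 2: `Ṡ₂ ≤ -d b2² S₂ + Fr L² S₁² < 0` using `L ≤ b2`
      have hk2 : S 2 t = 9 / 10 := hk
      change -(d * b2 ^ ((2 : Fin 3) : ℕ)) * S 2 t + Fr * L ^ ((2 : Fin 3) : ℕ) *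
        ((if ((2 : Fin 3) : ℕ) = 0 then v t else S (2 - 1) t) ^ 2 - p * S 2 t * (if ((2 : Fin 3) : ℕ) = 2 then y t else S (2 + 1) t)) < 0
      simp only [Fin.val_two, show ((2 : ℕ) = 0) = False by decide, if_false, if_true,
        show (2 : ℕ) - 1 = 1 from rfl]
      have hsq : S 1 t ^ 2 ≤ 81 / 100 := by nlinarith
      have hdr : 0 ≤ p * S 2 t * y t := by positivity
      have hL2 : L ^ 2 ≤ b2 ^ 2 := pow_le_pow_left₀ hL hLb 2
      have hFL : 0 ≤ Fr * L ^ 2 := mul_nonneg hFr.le (pow_nonneg hL 2)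
      have a1 : Fr * L ^ 2 * (S 1 t ^ 2 - p * S 2 t * y t) ≤ Fr * L ^ 2 * (81 / 100) :=
        mul_le_mul_of_nonneg_left (by linarith) hFL
      have a2 : Fr * L ^ 2 * (81 / 100 : ℝ) ≤ Fr * b2 ^ 2 * (81 / 100) := by
        have := mul_le_mul_of_nonneg_left hL2 hFr.le
        nlinarith
      have hb22 : 0 < b2 ^ 2 := by positivity
      have a3 : 7 / 6 * Fr * b2 ^ 2 ≤ d * b2 ^ 2 := mul_le_mul_of_nonneg_right hdlo hb22.le
      have hFb : 0 < Fr * b2 ^ 2 := mul_pos hFr hb22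
      have e : -(d * b2 ^ 2) * S 2 t = -(9 / 10) * (d * b2 ^ 2) := by rw [hk2]; ring
      nlinarith
  have h0 : ∀ k : Fin 3, h k 0 ≤ 9 / 10 := by
    intro k
    have := hSinit k (by have := k.is_lt; omega)
    change S k 0 ≤ 9 / 10
    linarith
  have hall := forall_le_of_hasDerivWithinAt_Ici_of_active_lt (c := fun _ => (9 / 10 : ℝ)) hcont' hder hface h0
  intro i hi t ht
  have := hall t ht ⟨i, by omega⟩
  change S i t ≤ 9 / 10 at this
  linarith

end Summit.NavierStokesRegularity.NavierStokesRegularity.Theorems.VirtualFloor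

end
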